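import Mathlib.RingTheory.MvPolynomial.Basic
import Mathlib.Algebra.DualNumber
import Mathlib.RingTheory.Ideal.Quotient.Operations
import Mathlib.Algebra.CharP.Two
import Mathlib.Tactic.LinearCombination
import HarnessLib

/-!
# Hauser's kangaroo specimen is not F-injective

Route `FrobeniusLadder`, crux `FRationalResolution` (stmt-ResolutionOfSingularities-15317), line
`Sketch`, barrier calibration. Hauser's kangaroo sequence (barrier
`Literature.Barriers.ResolutionOfSingularities.KangarooShadeIncrease`; Hauser 2003 §14 Ex. 2,
Hauser 2008 (arXiv:0811.4151) §G) starts from the purely inseparable surface `x² + y⁷ + y·z⁴ = 0` over a field `k` of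
characteristic `2`. This file shows that its local ring at the origin is NOT F-injective: in
`A = k[x, y, z]/(x² + y⁷ + yz⁴)` the parameter ideal `I = (y, z)` is not Frobenius closed, since
`x ∉ (y, z)` but `x² = -(y⁵·y² + (y z²)·z²) ∈ I^[2] = (w² : w ∈ I)`. Hence the origin is not
F-rational either, so the catalogued specimen behind the crux's own why-might-fail ("kangaroo-type
residual-order jumps") lies OUTSIDE the residual class of F-rational germs — exactly like the
Cossart–Piltant specimen (`CPSpecimenNotFClosed`, stmt-ResolutionOfSingularities-15335, proved in
`FrobeniusLadderCPSpecimenNotFClosed`). The same two-line computation is recorded for the kangaroo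
point `x² + z⁶·(y⁵ + y⁴ + y³ + y²) = 0` itself (`kangarooPoint_not_frobeniusClosed`).

Proof of `x ∉ (y, z)`: the `k`-algebra map `k[x, y, z] → k[ε]/(ε²)` (dual numbers), `x ↦ ε`,
`y, z ↦ 0`, kills the defining equation (as `ε² = 0`), hence factors through `A`; it kills `y, z`,
hence `I`, but sends `x` to `ε ≠ 0` (`kangarooSpecimen_mk_X_zero_notMem`).
-/

-- single-problem summit: the doubled namespace component is forced
set_option linter.dupNamespace false

namespace Summit.ResolutionOfSingularities.ResolutionOfSingularities.Theorems.FRationalResolution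

open MvPolynomial

/-- **Dual-number test for `x ∉ (y, z)`.** If `g ∈ k[X₀, X₁, X₂]` is killed by the evaluation
`X₀ ↦ ε`, `X₁, X₂ ↦ 0` into the dual numbers `k[ε]`, then in `k[X₀, X₁, X₂]/(g)` the class of `X₀`
does not lie in the ideal generated by the classes of `X₁` and `X₂`: the evaluation factors through
the quotient, kills that ideal, and sends the class of `X₀` to `ε ≠ 0`. [folklore] -/
theorem kangarooSpecimen_mk_X_zero_notMem {k : Type} [Field k] (g : MvPolynomial (Fin 3) k)
    (hg : MvPolynomial.aeval (Pi.single 0 DualNumber.eps : Fin 3 → DualNumber k) g = 0) :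
    Ideal.Quotient.mk (Ideal.span {g}) (X 0) ∉
      Ideal.span {Ideal.Quotient.mk (Ideal.span {g}) (X 1),
        Ideal.Quotient.mk (Ideal.span {g}) (X 2)} := by
  intro h0
  set v : Fin 3 → DualNumber k := Pi.single 0 DualNumber.eps with hv
  have hker : ∀ a ∈ Ideal.span {g}, (MvPolynomial.aeval v).toRingHom a = 0 := by
    intro a ha
    obtain ⟨c, rfl⟩ := Ideal.mem_span_singleton'.mp ha
    simp [hg]
  obtain ⟨θ, hθ⟩ : ∃ θ : MvPolynomial (Fin 3) k ⧸ Ideal.span {g} →+* DualNumber k,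
      ∀ i, θ (Ideal.Quotient.mk (Ideal.span {g}) (X i)) = v i :=
    ⟨Ideal.Quotient.lift (Ideal.span {g}) (MvPolynomial.aeval v).toRingHom hker, fun i => by
      rw [Ideal.Quotient.lift_mk]
      exact MvPolynomial.aeval_X v i⟩
  have hIle : Ideal.span {Ideal.Quotient.mk (Ideal.span {g}) (X 1),
      Ideal.Quotient.mk (Ideal.span {g}) (X 2)} ≤ RingHom.ker θ := by
    rw [Ideal.span_le]
    rintro x (rfl | rfl) <;> simp [RingHom.mem_ker, hθ, hv]
  have h1 : θ (Ideal.Quotient.mk (Ideal.span {g}) (X 0)) = 0 := (RingHom.mem_ker).mp (hIle h0)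
  rw [hθ, hv, Pi.single_eq_same] at h1
  have h2 := congrArg TrivSqZeroExt.snd h1
  simp at h2

/-- **Hauser's kangaroo specimen is not F-injective at the origin** (route FrobeniusLadder, crux
stmt-ResolutionOfSingularities-15317, barrier calibration): over a field `k` of characteristic `2`,
in `A = k[X₀, X₁, X₂]/(X₀² + X₁⁷ + X₁X₂⁴)` the class `u₀` of `X₀` is not in the parameter ideal
`I = (u₁, u₂)` although `u₀² ∈ I^[2] = (w² : w ∈ I)`. Proof: `u₀² = -(u₁⁵·u₁² + (u₁u₂²)·u₂²)`;
and the evaluation `X₀ ↦ ε`, `X₁, X₂ ↦ 0` into the dual numbers `k[ε]` factors through `A`, kills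
`I` and maps `u₀` to `ε ≠ 0`. [cite: Hauser2003, §14 Ex. 2] -/
theorem kangarooSpecimen_not_frobeniusClosed (k : Type) [Field k] [CharP k 2] :
    let f : MvPolynomial (Fin 3) k :=
      MvPolynomial.X 0 ^ 2 + MvPolynomial.X 1 ^ 7 + MvPolynomial.X 1 * MvPolynomial.X 2 ^ 4;
    let A := MvPolynomial (Fin 3) k ⧸ Ideal.span {f};
    let u : Fin 3 → A := fun i => Ideal.Quotient.mk (Ideal.span {f}) (MvPolynomial.X i);
    let I : Ideal A := Ideal.span {u 1, u 2};
    u 0 ∉ I ∧ u 0 ^ 2 ∈ Ideal.span ((fun z : A => z ^ 2) '' (I : Set A)) := by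
  intro f A u I
  have hf : f = X 0 ^ 2 + X 1 ^ 7 + X 1 * X 2 ^ 4 := rfl
  have hu : ∀ i, u i = Ideal.Quotient.mk (Ideal.span {f}) (X i) := fun _ => rfl
  have hI : I = Ideal.span {u 1, u 2} := rfl
  refine ⟨?_, ?_⟩
  · -- `u 0 ∉ I`: the dual-number test
    rw [hI, hu, hu, hu]
    refine kangarooSpecimen_mk_X_zero_notMem f ?_
    rw [hf]
    simp
  · -- `u 0 ^ 2 ∈ I^[2]`, from the defining relation of `A`
    have hrel : u 0 ^ 2 + u 1 ^ 7 + u 1 * u 2 ^ 4 = 0 := by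
      have h : Ideal.Quotient.mk (Ideal.span {f}) (X 0 ^ 2 + X 1 ^ 7 + X 1 * X 2 ^ 4) = 0 :=
        Ideal.Quotient.eq_zero_iff_mem.mpr (Ideal.mem_span_singleton_self f)
      simpa only [map_add, map_mul, map_pow, ← hu] using h
    have h1 : u 1 ∈ I := by rw [hI]; exact Ideal.subset_span (by simp)
    have h2 : u 2 ∈ I := by rw [hI]; exact Ideal.subset_span (by simp)
    have heq : u 0 ^ 2 = -(u 1 ^ 5 * u 1 ^ 2 + u 1 * u 2 ^ 2 * u 2 ^ 2) := by
      linear_combination hrel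
    rw [heq]
    refine neg_mem (add_mem (Ideal.mul_mem_left _ _ ?_) (Ideal.mul_mem_left _ _ ?_))
    · exact Ideal.subset_span ⟨u 1, h1, rfl⟩
    · exact Ideal.subset_span ⟨u 2, h2, rfl⟩

/-- **The kangaroo point itself is not F-injective** (same calibration, the point `a³` of Hauser's
kangaroo sequence): over a field `k` of characteristic `2`, in
`A = k[X₀, X₁, X₂]/(X₀² + X₂⁶·(X₁⁵ + X₁⁴ + X₁³ + X₁²))` the class `u₀` of `X₀` is not in
`I = (u₁, u₂)` although `u₀² = -((u₂⁴·(u₁⁵ + u₁⁴ + u₁³ + u₁²))·u₂²) ∈ I^[2]`; `u₀ ∉ I` by the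
dual-number test `X₀ ↦ ε`, `X₁, X₂ ↦ 0`. [cite: Hauser2008Kangaroo, §G] -/
theorem kangarooPoint_not_frobeniusClosed (k : Type) [Field k] [CharP k 2] :
    let f : MvPolynomial (Fin 3) k :=
      MvPolynomial.X 0 ^ 2 + MvPolynomial.X 2 ^ 6 *
        (MvPolynomial.X 1 ^ 5 + MvPolynomial.X 1 ^ 4 + MvPolynomial.X 1 ^ 3 + MvPolynomial.X 1 ^ 2);
    let A := MvPolynomial (Fin 3) k ⧸ Ideal.span {f};
    let u : Fin 3 → A := fun i => Ideal.Quotient.mk (Ideal.span {f}) (MvPolynomial.X i);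
    let I : Ideal A := Ideal.span {u 1, u 2};
    u 0 ∉ I ∧ u 0 ^ 2 ∈ Ideal.span ((fun z : A => z ^ 2) '' (I : Set A)) := by
  intro f A u I
  have hf : f = X 0 ^ 2 + X 2 ^ 6 * (X 1 ^ 5 + X 1 ^ 4 + X 1 ^ 3 + X 1 ^ 2) := rfl
  have hu : ∀ i, u i = Ideal.Quotient.mk (Ideal.span {f}) (X i) := fun _ => rfl
  have hI : I = Ideal.span {u 1, u 2} := rfl
  refine ⟨?_, ?_⟩
  · -- `u 0 ∉ I`: the dual-number test
    rw [hI, hu, hu, hu]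
    refine kangarooSpecimen_mk_X_zero_notMem f ?_
    rw [hf]
    simp
  · -- `u 0 ^ 2 ∈ I^[2]`, from the defining relation of `A`
    have hrel : u 0 ^ 2 + u 2 ^ 6 * (u 1 ^ 5 + u 1 ^ 4 + u 1 ^ 3 + u 1 ^ 2) = 0 := by
      have h : Ideal.Quotient.mk (Ideal.span {f})
          (X 0 ^ 2 + X 2 ^ 6 * (X 1 ^ 5 + X 1 ^ 4 + X 1 ^ 3 + X 1 ^ 2)) = 0 :=
        Ideal.Quotient.eq_zero_iff_mem.mpr (Ideal.mem_span_singleton_self f)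
      simpa only [map_add, map_mul, map_pow, ← hu] using h
    have h2 : u 2 ∈ I := by rw [hI]; exact Ideal.subset_span (by simp)
    have heq : u 0 ^ 2 = -(u 2 ^ 4 * (u 1 ^ 5 + u 1 ^ 4 + u 1 ^ 3 + u 1 ^ 2) * u 2 ^ 2) := by
      linear_combination hrel
    rw [heq]
    exact neg_mem (Ideal.mul_mem_left _ _ (Ideal.subset_span ⟨u 2, h2, rfl⟩))

end Summit.ResolutionOfSingularities.ResolutionOfSingularities.Theorems.FRationalResolution
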